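import Summits.RiemannHypothesis.RiemannHypothesis.Theorems.TiltedLandingLaw421R3FlatMenuBBChecker

/-!
# «FlatMenuBBCert» (W-08 C1, rh-idea-5 g42; module 2 of 4 of «FlatMenuBB»)

ONE declaration: the kernel evaluation of the branch-and-bound of module 1 on chart 1 `[0,1] × [1,171]`
(`bb 60 0 1 1 171 = true`: 2993 nodes, 1375 certified leaves + 122 free boxes, depth ≤ 19; `decide +kernel`, no `ofReduceBool`).
Its MEANING (the three PH reads at every real point of the chart) is module 3's `bb_sound`, applied in module 4.
Nothing here bears on the truth of RH; RH is not proved (this is a SUPPORT computation for the E5 leaf of the W-08 sink line, not the crux).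
-/

namespace RhW08.FlatMenuBB

set_option maxRecDepth 100000 in
/-- ★★★ the B&B certificate for chart 1 `[0,1] × [1,171]`, checked by the KERNEL (`decide +kernel`, ≈ 2–3 min on the farm; no extra axioms). -/
theorem bb_chart1 : bb 60 0 1 1 171 = true := by decide +kernel

end RhW08.FlatMenuBB
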